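import Summits.CriticalPhenomena.CardyFormulaZ2.Theorems.CardyComplexConeParafermionToSLESixFamiliesDiamondDefs
import HarnessLib

/-!
# Line `potential-darboux-picard-diamond`, stub S4 (`stub_identifyPotential`): monotonicity of the renormalised touch mass

Helper file of the stub `stub_identifyPotential` of crux `ParafermionToSLESixFamilies` (stmt-CriticalPhenomena-11389).
Step (iii) of the identification combines clause (c) of `ClosedPrecompactness` (S3: touch mass `≥ c₀` on the middle half
`[‖q−p‖/4, 3‖q−p‖/4]` of a free segment) with (LOW) of `ExactPotentialTrace` (S1: progress along `τ` dominates the touch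
mass strictly between two side cells); the two windows differ, and the comparison needs the MONOTONICITY of
`touchMass E δ p q s t` in the window `[s, t]`. This file proves it (`touchMass_mono`, registered helper of the crux item):
the summation set is finite for `δ > 0` (lattice sites whose mesh point lies within `3δ` of the bounded segment,
`finite_near_segment`) and the touch probabilities are non-negative.
-/

noncomputable section

namespace Summit.CriticalPhenomena.CardyFormulaZ2.Cruxes.ParafermionToSLESixFamilies.PotentialDarbouxPicardDiamond

open scoped Topology BigOperators
open Filter Set Metric Complex
open Literature.Probability.LatticeModels
open Summit.CriticalPhenomena.CardyFormulaZ2.Cruxes.ParafermionToSLESixFamilies.IicTraceFluxPairing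

/-- For a positive mesh, only finitely many lattice sites have their mesh point within `3δ` of a segment. -/
theorem finite_near_segment {δ : ℝ} (hδ : 0 < δ) (p q : ℂ) :
    {x : Site 2 | infDist (meshPoint δ x) (segment ℝ p q) ≤ 3 * δ}.Finite := by
  have hb : Bornology.IsBounded {z : ℂ | infDist z (segment ℝ p q) ≤ 3 * δ} := by
    refine (isBounded_closedBall (x := p) (r := 3 * δ + 1 + dist p q)).subset fun z hz => ?_
    rw [mem_closedBall]
    have hz' : infDist z (segment ℝ p q) < 3 * δ + 1 := by
      have : infDist z (segment ℝ p q) ≤ 3 * δ := hz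
      linarith
    obtain ⟨y, hy, hzy⟩ := (infDist_lt_iff ⟨p, left_mem_segment ℝ p q⟩).1 hz'
    have hyp : dist y p ≤ dist p q := by
      have := segment_subset_closedBall_left p q hy
      rwa [mem_closedBall] at this
    calc dist z p ≤ dist z y + dist y p := dist_triangle _ _ _
      _ ≤ 3 * δ + 1 + dist p q := by linarith
  exact meshVertices_finite hb hδ

/-- **Monotonicity of the touch mass in its window.** For a positive mesh, enlarging the window `[s, t]` can only
increase `touchMass E δ p q s t` (a finite sum of non-negative touch probabilities over a larger index set). -/
theorem touchMass_mono : ∀ (E : DiscreteDobrushin) (δ : ℝ) (p q : ℂ) (s t s' t' : ℝ), 0 < δ → s' ≤ s → t ≤ t' → touchMass E δ p q s t ≤ touchMass E δ p q s' t' := by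
  intro E δ p q s t s' t' hδ hs ht
  unfold touchMass
  refine mul_le_mul_of_nonneg_left ?_ (Real.rpow_nonneg hδ.le _)
  set A : Set (Site 2) := {x ∈ touchSites E | infDist (meshPoint δ x) (segment ℝ p q) ≤ 3 * δ ∧
    s ≤ proj p q (meshPoint δ x) ∧ proj p q (meshPoint δ x) ≤ t} with hA
  set A' : Set (Site 2) := {x ∈ touchSites E | infDist (meshPoint δ x) (segment ℝ p q) ≤ 3 * δ ∧
    s' ≤ proj p q (meshPoint δ x) ∧ proj p q (meshPoint δ x) ≤ t'} with hA'
  have hAA' : A ⊆ A' := fun x hx => ⟨hx.1, hx.2.1, hs.trans hx.2.2.1, hx.2.2.2.trans ht⟩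
  have hfin : ∀ B : Set (Site 2), B ⊆ {x : Site 2 | infDist (meshPoint δ x) (segment ℝ p q) ≤ 3 * δ} →
      Function.HasFiniteSupport (B.indicator (touchProb E)) := fun B hB =>
    ((finite_near_segment hδ p q).subset hB).subset (support_indicator_subset)
  have hnn : ∀ x, 0 ≤ touchProb E x := fun x => MeasureTheory.measureReal_nonneg
  refine finsum_le_finsum' (hfin A fun x hx => hx.2.1) (hfin A' fun x hx => hx.2.1) fun x => ?_
  exact indicator_le_indicator_of_subset hAA' hnn x

end Summit.CriticalPhenomena.CardyFormulaZ2.Cruxes.ParafermionToSLESixFamilies.PotentialDarbouxPicardDiamond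

end
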